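import Summits.BirchSwinnertonDyer.BirchSwinnertonDyer.Theorems.CyclotomicUntwistFormalEtaCoboundary
import HarnessLib

/-!
# Route `CyclotomicUntwist`: the class of `η = x·ω` is of the SECOND KIND — Part III: base change and INTEGRALITY
# of the coboundary of `formalEtaIntegral`; `[η_W] ∈ D(Ê/𝓞_{ℚ₃(ζ₉)})` for every good model

Cell `pub/bsd-wall` (D-0145 line `route-BirchSwinnertonDyer-CyclotomicUntwist`), prover seat `bsd-line-cycu-p5`
(gen 10), lane «the η-class is of the second kind». THEOREMS ONLY (no definition, no named fact, no `sorry`);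
helper `--supports` K1 = stmt-BirchSwinnertonDyer-21580 (serves K2 = 21581 and the print input
`isDescendedFrobeniusMatrix_exists` of C2 = 27549). BSD is not proved by this file and no crux is.

WHAT. The Literature definition `WeierstrassCurve.formalEtaIntegral` (`DescendedFrobeniusMatrix.lean`) represents the
de Rham class of `η = x·ω` in Katz's module `D(Ê/R) = {f : f(0) = 0, df integral, ∂f integral}/{integral}`
([Katz 1981, §5.1 p. 193]) by the regular series `L_η = ∫(xω − dz/z²) = Σ_{n ≥ 1} (P_{n+1}/n) zⁿ`,
`P = z²x·(ω/dz)`. For `[η]` to BE an element of `D(Ê/R)` its coboundary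
`∂L_η := L_η(F(z₁,z₂)) − L_η(z₁) − L_η(z₂)` (`F = formalGroupLaw`, AEC IV.1) must have coefficients in `R`
(primitivity; the `[ω]`-half is `log F = log z₁ + log z₂`, `formalLog_subst_formalGroupLaw`). Part II
(`…FormalEtaCoboundary.lean`) proves the CLOSED FORM, for every Weierstrass curve over a `ℚ`-algebra domain,

  `∂L_η = a₁ − (a₁ + a₃λ + a₄ν + 2a₆λν)·(1 − a₃ν − a₆ν²)⁻¹ + a₃·z₃²·B(z₃)`     (`formalEtaIntegral_coboundary_eq`)

(`λ = formalSlope`, `ν = formalIntercept`, `z₃ = formalChordZ`, `B = formalWDivCube`, all with coefficients in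
`ℤ[a₁,…,a₆]`), i.e. the `z`-expansion of the classical addition law of the Weierstrass `ζ`-function
`ζ(u+v) − ζ(u) − ζ(v) = ½(℘′(u) − ℘′(v))/(℘(u) − ℘(v))` with the polar parts `1/z` removed:
`∂L_η = 1/F − 1/z₁ − 1/z₂ − λ/ν` (`λ/ν` = the `(x,y)`-slope of the chord), rewritten through Vieta for the chord
cubic (`D·z₁z₂z₃ = ν(1 − a₃ν − a₆ν²)`, `D·(z₁z₂ + z₁z₃ + z₂z₃) = c₁`) into a power series. PROOF: both sides vanish
at `z = 0` and have the same partial derivatives: `ηᵢ·∂ᵢ(∂L_η) = q(F) − q(zᵢ)` with `q = (z²x − η)/z²`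
(invariance `ηᵢ∂ᵢF = η(F)`), while `∂ᵢ` of the right side is computed from `ηᵢ∂ᵢλ = D(zᵢ − z₃)`,
`∂ᵢν = −zⱼ∂ᵢλ` (the differentiated incidences) and reduces, after clearing denominators, to `x(F) − xᵢ =
ν(z₃ − zᵢ)/(wᵢw₃)` and the Vieta product `D·w₁w₂w₃ = ν³`. CONSEQUENCE (`coeff_coboundary_mem_range`): for a
Weierstrass equation with coefficients in a subring `R → A`, every coefficient of `∂L_η` lies in `R` — in
particular for a good model over `𝓞 = 𝓞_{ℚ₃(ζ₉)}` the class `classEta` has `𝓞`-INTEGRAL coboundary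
(`isIntegral_coeff_coboundary_formalEtaIntegral`), so `[η] ∈ D(Ê/𝓞)` (Katz L. 5.1.2 + primitivity, in kernel).
[cite: Katz1981CrystallineDieudonne, §5.1 (p. 193), Lemma 5.1.2] [cite: SilvermanAEC2009, IV.1, III.5.1]
-/

set_option autoImplicit false
-- single-conjunct summit: `Summit.BirchSwinnertonDyer.BirchSwinnertonDyer.…` repeats the name by design
set_option linter.dupNamespace false

noncomputable section

open PowerSeries Literature.NumberTheory.EllipticCurves
open Literature.AlgebraicGeometry.Resolution (MvPowerSeries.pderiv MvPowerSeries.coeff_pderiv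
  MvPowerSeries.pderiv_X MvPowerSeries.pderiv_C MvPowerSeries.pderiv_powerSeries_subst
  MvPowerSeries.pderiv_powerSeries_subst_X MvPowerSeries.coeff_eq_zero_of_pderiv_eq_zero)

namespace Summit.BirchSwinnertonDyer.BirchSwinnertonDyer.Theorems.FormalEtaCoboundary

/-! ## §4 Base change and INTEGRALITY: `[η] ∈ D(Ê/R)`; the good models over `𝓞_{ℚ₃(ζ₉)}` -/

section BaseChange

variable {R S : Type*} [CommRing R] [CommRing S] (W : WeierstrassCurve R) (φ : R →+* S)

/-- The closed form commutes with base change (all its ingredients have coefficients in `ℤ[a₁,…,a₆]`).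
[cite: SilvermanAEC2009, IV.1.1] -/
theorem map_closedForm :
    MvPowerSeries.map φ (MvPowerSeries.C W.a₁ - (MvPowerSeries.C W.a₁ + MvPowerSeries.C W.a₃ * W.formalSlope +
            MvPowerSeries.C W.a₄ * W.formalIntercept + 2 * MvPowerSeries.C W.a₆ * W.formalSlope * W.formalIntercept) *
          MvPowerSeries.invOfUnit (1 - MvPowerSeries.C W.a₃ * W.formalIntercept -
            MvPowerSeries.C W.a₆ * W.formalIntercept ^ 2) 1 +
        MvPowerSeries.C W.a₃ * (W.formalChordZ ^ 2 * W.formalWDivCube.subst W.formalChordZ)) =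
      MvPowerSeries.C (W.map φ).a₁ - (MvPowerSeries.C (W.map φ).a₁ + MvPowerSeries.C (W.map φ).a₃ * (W.map φ).formalSlope +
            MvPowerSeries.C (W.map φ).a₄ * (W.map φ).formalIntercept +
            2 * MvPowerSeries.C (W.map φ).a₆ * (W.map φ).formalSlope * (W.map φ).formalIntercept) *
          MvPowerSeries.invOfUnit (1 - MvPowerSeries.C (W.map φ).a₃ * (W.map φ).formalIntercept -
            MvPowerSeries.C (W.map φ).a₆ * (W.map φ).formalIntercept ^ 2) 1 +
        MvPowerSeries.C (W.map φ).a₃ * ((W.map φ).formalChordZ ^ 2 * (W.map φ).formalWDivCube.subst (W.map φ).formalChordZ) := by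
  have hM : MvPowerSeries.constantCoeff (1 - MvPowerSeries.C W.a₃ * W.formalIntercept -
      MvPowerSeries.C W.a₆ * W.formalIntercept ^ 2) = 1 := by simp [W.constantCoeff_formalIntercept]
  simp only [map_sub, map_add, map_mul, map_pow, map_one, MvPowerSeries.map_C, map_ofNat,
    mvPowerSeries_map_invOfUnit_one φ _ hM, W.map_formalSlope φ, W.map_formalIntercept φ, W.map_formalChordZ φ,
    PowerSeries.map_subst W.hasSubst_formalChordZ, W.map_formalWDivCube φ]
  rfl

/-- **Integrality of the coboundary.** For a Weierstrass equation with coefficients in `R` and a ring map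
`φ : R → A` to a `ℚ`-algebra domain, the coboundary of `L_η` of `W ⊗ A` is the base change of a series over
`R` (the closed form): every coefficient lies in `φ(R)`. [cite: Katz1981CrystallineDieudonne, §5.1 (p. 193)] -/
theorem coboundary_eq_map {A : Type*} [CommRing A] [IsDomain A] [Algebra ℚ A] (φ : R →+* A) :
    (W.map φ).formalEtaIntegral.subst (W.map φ).formalGroupLaw -
        (W.map φ).formalEtaIntegral.subst (MvPowerSeries.X 0 : MvPowerSeries (Fin 2) A) -
        (W.map φ).formalEtaIntegral.subst (MvPowerSeries.X 1 : MvPowerSeries (Fin 2) A) =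
      MvPowerSeries.map φ (MvPowerSeries.C W.a₁ - (MvPowerSeries.C W.a₁ + MvPowerSeries.C W.a₃ * W.formalSlope +
            MvPowerSeries.C W.a₄ * W.formalIntercept + 2 * MvPowerSeries.C W.a₆ * W.formalSlope * W.formalIntercept) *
          MvPowerSeries.invOfUnit (1 - MvPowerSeries.C W.a₃ * W.formalIntercept -
            MvPowerSeries.C W.a₆ * W.formalIntercept ^ 2) 1 +
        MvPowerSeries.C W.a₃ * (W.formalChordZ ^ 2 * W.formalWDivCube.subst W.formalChordZ)) := by
  rw [map_closedForm, formalEtaIntegral_coboundary_eq]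

/-- Every coefficient of the coboundary of `L_η` of `W ⊗_φ A` lies in the image of `R`.
[cite: Katz1981CrystallineDieudonne, §5.1 (p. 193)] -/
theorem coeff_coboundary_mem_range {A : Type*} [CommRing A] [IsDomain A] [Algebra ℚ A] (φ : R →+* A)
    (d : Fin 2 →₀ ℕ) :
    MvPowerSeries.coeff d ((W.map φ).formalEtaIntegral.subst (W.map φ).formalGroupLaw -
        (W.map φ).formalEtaIntegral.subst (MvPowerSeries.X 0 : MvPowerSeries (Fin 2) A) -
        (W.map φ).formalEtaIntegral.subst (MvPowerSeries.X 1 : MvPowerSeries (Fin 2) A)) ∈ φ.range := by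
  rw [coboundary_eq_map, MvPowerSeries.coeff_map]
  exact ⟨_, rfl⟩

end BaseChange

section NineGoodModel

open Literature.NumberTheory.EllipticCurves.DescendedFrobenius

/-- **`[η]` is a class of Katz's `D(Ê/𝓞)`, `𝓞 = 𝓞_{ℚ₃(ζ₉)}`**: for a Weierstrass equation `E` over `𝓞 = ONine`, every
coefficient of the coboundary `L_η(F) − L_η(z₁) − L_η(z₂)` of `E ⊗ ℚ₃(ζ₉)` is `ℤ₃`-integral (lies in `𝓞`).
[cite: Katz1981CrystallineDieudonne, §5.1 (p. 193), Lemma 5.1.2] -/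
theorem isIntegral_coeff_coboundary_formalEtaIntegral (E : WeierstrassCurve ONine) (d : Fin 2 →₀ ℕ) :
    IsIntegral ℤ_[3] (MvPowerSeries.coeff d
      ((E.map (algebraMap ONine KNine)).formalEtaIntegral.subst (E.map (algebraMap ONine KNine)).formalGroupLaw -
        (E.map (algebraMap ONine KNine)).formalEtaIntegral.subst (MvPowerSeries.X 0 : MvPowerSeries (Fin 2) KNine) -
        (E.map (algebraMap ONine KNine)).formalEtaIntegral.subst (MvPowerSeries.X 1 : MvPowerSeries (Fin 2) KNine))) := by
  obtain ⟨x, hx⟩ := coeff_coboundary_mem_range E (algebraMap ONine KNine) d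
  rw [← hx]
  exact x.2

/-- **The coboundary of `classEta` of a good model** `𝓜` of `W/ℚ` over `𝓞_{ℚ₃(ζ₉)}` (`classEta = u·L_η(𝓜) +
ru⁻¹·log(𝓜)`, `log` additive): `∂ classEta = u · (the closed form of 𝓜.E, an 𝓞-integral series)`. So `[η_W]` lies in
Katz's `D(Ê/𝓞) ⊗ ℚ` with an EXPLICIT integral coboundary after the scalar `u`.
[cite: Katz1981CrystallineDieudonne, §5.1 (p. 193)] -/
theorem coboundary_classEta {W : WeierstrassCurve ℚ} (𝓜 : W.NineGoodModel) :
    𝓜.classEta.subst 𝓜.curve.formalGroupLaw - 𝓜.classEta.subst (MvPowerSeries.X 0 : MvPowerSeries (Fin 2) KNine) -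
        𝓜.classEta.subst (MvPowerSeries.X 1 : MvPowerSeries (Fin 2) KNine) =
      MvPowerSeries.C (𝓜.C.u : KNine) * MvPowerSeries.map (algebraMap ONine KNine)
        (MvPowerSeries.C 𝓜.E.a₁ - (MvPowerSeries.C 𝓜.E.a₁ + MvPowerSeries.C 𝓜.E.a₃ * 𝓜.E.formalSlope +
            MvPowerSeries.C 𝓜.E.a₄ * 𝓜.E.formalIntercept + 2 * MvPowerSeries.C 𝓜.E.a₆ * 𝓜.E.formalSlope * 𝓜.E.formalIntercept) *
          MvPowerSeries.invOfUnit (1 - MvPowerSeries.C 𝓜.E.a₃ * 𝓜.E.formalIntercept -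
            MvPowerSeries.C 𝓜.E.a₆ * 𝓜.E.formalIntercept ^ 2) 1 +
        MvPowerSeries.C 𝓜.E.a₃ * (𝓜.E.formalChordZ ^ 2 * 𝓜.E.formalWDivCube.subst 𝓜.E.formalChordZ)) := by
  have hF := 𝓜.curve.hasSubst_formalGroupLaw
  have hX0 : PowerSeries.HasSubst (MvPowerSeries.X 0 : MvPowerSeries (Fin 2) KNine) := PowerSeries.HasSubst.X 0
  have hX1 : PowerSeries.HasSubst (MvPowerSeries.X 1 : MvPowerSeries (Fin 2) KNine) := PowerSeries.HasSubst.X 1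
  have hlog := 𝓜.curve.formalLog_subst_formalGroupLaw
  have hη := coboundary_eq_map 𝓜.E (algebraMap ONine KNine)
  have hsub : ∀ {g : MvPowerSeries (Fin 2) KNine} (hg : PowerSeries.HasSubst g),
      𝓜.classEta.subst g = MvPowerSeries.C (𝓜.C.u : KNine) * 𝓜.curve.formalEtaIntegral.subst g +
        MvPowerSeries.C (𝓜.C.r * ((𝓜.C.u⁻¹ : KNineˣ) : KNine)) * 𝓜.curve.formalLog.subst g := by
    intro g hg
    rw [WeierstrassCurve.NineGoodModel.classEta, PowerSeries.subst_add hg, PowerSeries.smul_eq_C_mul,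
      PowerSeries.smul_eq_C_mul, PowerSeries.subst_mul hg, PowerSeries.subst_mul hg, PowerSeries.subst_C,
      PowerSeries.subst_C]
  rw [hsub hF, hsub hX0, hsub hX1]
  unfold WeierstrassCurve.NineGoodModel.curve at hlog ⊢
  rw [← hη]
  linear_combination (MvPowerSeries.C (𝓜.C.r * ((𝓜.C.u⁻¹ : KNineˣ) : KNine))) * hlog

end NineGoodModel

end Summit.BirchSwinnertonDyer.BirchSwinnertonDyer.Theorems.FormalEtaCoboundary

end
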